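import Summits.Ventures.CertifiedManyBodySolver.Theorems.M3x2EdgeSplitSymReplayBoxCanon
import HarnessLib

/-!
# SymReplay box canon — E0-Z: the affine-`D₄` MOVE in closed form, a drop-in twin of the box canon of record (executable lever; equalities proved)

The box canon of record (`…BoxCanon`: `anchoredNFsB` → `canonAB` → `canonTermAB` → `canonNFZB` → `shardOKRGB`) moves every
word twice per point-group element (corner probe at translation `0`, then the anchored move) with `moveWordV`, whose sites come
from `d4R` = the `k`-fold iterate of `v ↦ ![−v 1, v 0]` read back through `Fin.cons` closures.  Under the evaluator that
`native_decide` runs at the gate this move is the dominant cost of the canon third: measured 64–84 µs per image against ≈ 20–55 µs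
for `nfWord` of the moved word (hub-lb-sym-plan-1 g4 benches, pub `hub-lb-sym-plan-1/e5/`).

This file gives the SAME move in closed form on integer pairs — `rotZ` (structural in `k`, exactly like `d4R`'s iterate), `d4Z`,
`moveWordZ` (one `mkSite` per letter) — proves `moveWordZ_eq : moveWordZ γ v w = moveWordV γ v w`, and restates the five box-canon
executables verbatim with `moveWordZ` in place of `moveWordV` (`anchoredNFsBZ`, `canonABZ`, `canonTermABZ`, `canonNFZBZ`,
`shardOKRGBZ`), each PROVED equal to the executable of record as a function (`anchoredNFsBZ_eq`, …, `shardOKRGBZ_eq`, all by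
`funext` from `moveWordZ_eq`).  Nothing of the soundness chain is touched: the facts of record keep their statements.

MEASURED (interpreted, = the gate's `native_decide` evaluator; 0 disagreements in every run).  Synthetic normal 6-letter words
(1 912 words, 15 296 images): `canonTermAB` 1 608 → `canonTermABZ` 642 µs/word (÷2.5); move 84 → 22 µs/image; `nfWord ∘ move`
98 → 37.  REAL residual words of rung V (first 2 000 words of the shipped partial `Pg0`, lengths 4/6/8 = 121/978/899): `canonTermAB`
1 496–1 937 → `canonTermABZ` 678–1 008 µs/word (÷1.9–2.2, two runs); move 64 → 14 µs/image; `nfWord ∘ move` 120 → 54; `inBox ∘ move`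
67 → 16.

CONTENTS.  (a) `rotZ`, `d4Z`, `moveWordZ` with `rotZ_spec`, `d4Z_spec : d4Z γ (x 0) (x 1) = (d4R γ x 0, d4R γ x 1)`, `moveWordZ_eq`,
`moveWordZ_eq'` (as functions); (b) the twins `anchoredNFsBZ` … `shardOKRGBZ` and the equalities `anchoredNFsBZ_eq`, `canonABZ_eq`,
`canonTermABZ_eq`, `canonNFZBZ_eq`, `shardOKRGBZ_eq : shardOKRGBZ = shardOKRGB`.

CLOSING GRAMMAR (unchanged from `…BoxCanon` / `…OutRoute`; only the fact PROOFS change).  A shard fact of record is proved by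
evaluating the twin: `theorem f_j : shardOKRGB K c sizes lo hi j P = true := by rw [← shardOKRGBZ_eq]; native_decide`; a fact whose
executable wraps `canonNFZB` one definition deep (e.g. `outOKB K κ J lo hi i`) by `by unfold outOKB; rw [← canonNFZBZ_eq];
native_decide`.  `ShardFactsRGB` / `OutFactsB` and the closing theorems (`energyDensity_ge_of_shardsRGB`,
`energyDensity_ge_of_outrouteB`) are used exactly as before.

HONEST FRAMING: an executable lever with its equality proofs; no certificate is replayed here; no bound of record moves; no summit
or crux statement is proved; nothing here predicts superconductivity.
-/

namespace Summit.Ventures.CertifiedManyBodySolver.Theorems.SymReplay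

open Literature.MathematicalPhysics.QuantumLattice
open Literature.MathematicalPhysics.QuantumLattice.HubbardWave0
open Literature.Probability.LatticeModels

/-! ##### (a) The closed-form move -/

/-- `rotᵏ` on integer pairs (`rot (a,b) = (−b,a)`), structural on `k` exactly like `d4R`'s iterate. -/
def rotZ : ℕ → ℤ × ℤ → ℤ × ℤ
  | 0, p => p
  | k + 1, p => rotZ k (-p.2, p.1)

/-- The eight point-group maps on integer pairs (`r i ↦ rotⁱ`, `sr i ↦ refl ∘ rotⁱ`, `refl (a,b) = (a,−b)`). -/
def d4Z : DihedralGroup 4 → ℤ → ℤ → ℤ × ℤ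
  | .r i, a, b => rotZ i.val (a, b)
  | .sr i, a, b => let p := rotZ i.val (a, b); (p.1, -p.2)

/-- Closed-form move of a word (`= moveWordV`, `moveWordZ_eq`). -/
def moveWordZ (γ : DihedralGroup 4) (v : Site 2) (w : Word) : Word :=
  let v0 := v 0; let v1 := v 1
  w.map fun ℓ => let p := d4Z γ (ℓ.x 0) (ℓ.x 1); ⟨mkSite (p.1 + v0) (p.2 + v1), ℓ.s, ℓ.dag⟩

/-- `rotZ k` is the `k`-fold iterate of `v ↦ ![−v 1, v 0]`, read in coordinates. -/
theorem rotZ_spec : ∀ (k : ℕ) (x : Site 2),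
    rotZ k (x 0, x 1) = (((fun v : Site 2 => (![-v 1, v 0] : Site 2))^[k] x) 0, ((fun v : Site 2 => (![-v 1, v 0] : Site 2))^[k] x) 1)
  | 0, x => by simp [rotZ]
  | k + 1, x => by
    rw [rotZ, Function.iterate_succ_apply, ← rotZ_spec k]
    simp

/-- `d4Z` agrees with `d4R` coordinatewise (uniformly in `γ`, no case split on the rotation index). -/
theorem d4Z_spec (γ : DihedralGroup 4) (x : Site 2) : d4Z γ (x 0) (x 1) = (d4R γ x 0, d4R γ x 1) := by
  rcases γ with i | i
  · simp only [d4Z, d4R, rotZ_spec]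
  · simp only [d4Z, d4R, rotZ_spec]
    simp

/-- **The closed-form move IS the move of record.** -/
theorem moveWordZ_eq (γ : DihedralGroup 4) (v : Site 2) (w : Word) : moveWordZ γ v w = moveWordV γ v w := by
  unfold moveWordZ moveWordV
  refine List.map_congr_left fun ℓ _ => ?_
  simp only [d4Z_spec, moveSite, Pi.add_apply]

/-- `moveWordZ_eq` as an equality of functions (for rewriting under binders). -/
theorem moveWordZ_eq' : moveWordZ = moveWordV := by
  funext γ v w; exact moveWordZ_eq γ v w

/-! ##### (b) The box canon of record with closed-form moves (verbatim twins of `…BoxCanon`: `anchoredNFsB` … `shardOKRGB`) -/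

/-- Twin of `anchoredNFsB`: the in-box anchored normal forms of the eight images, moves closed-form. -/
def anchoredNFsBZ (lo hi : ℤ × ℤ) (u : Word) : List QPoly :=
  d4All.filterMap fun γ =>
    let m := minCornerP (wordSites (moveWordZ γ 0 u))
    let a := lo.1 - m.1
    let b := lo.2 - m.2
    let w := moveWordZ γ (mkSite a b) u
    if inBox lo hi w then some (nfWord w) else none

/-- Twin of `canonAB`. -/
def canonABZ (lo hi : ℤ × ℤ) (u : Word) : QPoly :=
  match anchoredNFsBZ lo hi u with
  | [] => [(1, u)]
  | c :: cs =>
    let best := cs.foldl (fun b c' => if polyKeyLt c' b then c' else b) c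
    if (c :: cs).any (polyNegEq best) then [] else best

/-- Twin of `canonTermAB`. -/
def canonTermABZ (lo hi : ℤ × ℤ) (t : ℚ × Word) : QPoly := pscale t.1 (canonABZ lo hi t.2)

/-- Twin of `canonNFZB`. -/
def canonNFZBZ (lo hi : ℤ × ℤ) (p : QPoly) : QPoly :=
  (dropZeros (collect (nfPoly p))).flatMap (canonTermABZ lo hi)

/-- Twin of `shardOKRGB` (the shard fact executable of record). -/
def shardOKRGBZ (K : SymCertR) (c : ℕ) (sizes : List ℕ) (lo hi : ℤ × ℤ) (j : ℕ) (P : QPoly) : Bool :=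
  psuppInB lo hi P && isZero (psub (canonNFZBZ lo hi (shardPolyAtRGFast K c sizes j)) P)

/-- `anchoredNFsBZ = anchoredNFsB`. -/
theorem anchoredNFsBZ_eq : anchoredNFsBZ = anchoredNFsB := by
  funext lo hi u; simp only [anchoredNFsBZ, anchoredNFsB, moveWordZ_eq']

/-- `canonABZ = canonAB`. -/
theorem canonABZ_eq : canonABZ = canonAB := by
  funext lo hi u
  unfold canonABZ canonAB
  rw [anchoredNFsBZ_eq]
  try rfl

/-- `canonTermABZ = canonTermAB`. -/
theorem canonTermABZ_eq : canonTermABZ = canonTermAB := by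
  funext lo hi t; simp only [canonTermABZ, canonTermAB, canonABZ_eq]

/-- `canonNFZBZ = canonNFZB`. -/
theorem canonNFZBZ_eq : canonNFZBZ = canonNFZB := by
  funext lo hi p; simp only [canonNFZBZ, canonNFZB, canonTermABZ_eq]

/-- **Drop-in**: `shardOKRGBZ = shardOKRGB` — a fact module states the fact of record and proves it `by rw [← shardOKRGBZ_eq]; native_decide`. -/
theorem shardOKRGBZ_eq : shardOKRGBZ = shardOKRGB := by
  funext K c sizes lo hi j P; simp only [shardOKRGBZ, shardOKRGB, canonNFZBZ_eq]

end Summit.Ventures.CertifiedManyBodySolver.Theorems.SymReplay
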